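import Literature.Analysis.FluidPDE.PeriodicLerayGalerkinPairings
import Literature.Analysis.FluidPDE.PeriodicLerayLimitWeakForm
import Literature.Analysis.FluidPDE.KNSSMollifiedSlice
import Literature.Analysis.FluidPDE.NSGaldiExtendedTest
import HarnessLib

/-!
# [BT1] proof of Theorem 2.4 — the Galerkin equations tested with time-dependent elements

Analysis/FluidPDE proof file (theorems only; no definitions, no named facts) in the DAG below the
named fact `Literature.Analysis.FluidPDE.bradshawTsai2017_thm_2_4_mollified`
(`PeriodicLerayExistence.lean`; Bradshaw–Tsai, Ann. Henri Poincaré 18 (2017) = arXiv:1510.07504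
[BT1], Lemma 2.6 and proof of Thm 2.4; Temam, *Navier–Stokes equations*, Ch. III §3,
(3.43)–(3.46)).

`intervalIntegral_galerkin_identity`: along a `T`-periodic solution `b` of the Galerkin system of
[BT1] Lemma 2.6 over an `L²`-orthonormal family `a₁, …, a_k` of test fields
(`U(s) = Σᵢ bᵢ(s) aᵢ`), every smooth `T`-periodic space–time field `g`, supported in a fixed ball
and with `g(s) ∈ span{aᵢ}` for every `s`, satisfies

  `∫₀ᵀ ( ∫ ⟪U(s), ∂ₛg(s)⟫ + RHS(s; U(s), g(s)) ) ds = 0`,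

`RHS = galerkinForm` being the tested right-hand side of the mollified perturbed Leray equations:
write `g(s) = Σᵢ cᵢ(s) aᵢ` with `cᵢ(s) = ∫⟪g(s), aᵢ⟫` (`C¹`, `T`-periodic), so that
`∫⟪U(s), g(s)⟫ = Σᵢ bᵢ(s)cᵢ(s)`, differentiate (`bᵢ' = RHS(s; U, aᵢ)`, linearity of `RHS` in the
test field, `∂ₛg = Σᵢ cᵢ' aᵢ`) and integrate over a period.

## References

* Z. Bradshaw, T.-P. Tsai, Ann. Henri Poincaré 18 (2017) = arXiv:1510.07504, Lemma 2.6, proof of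
  Thm 2.4 [BradshawTsai2017AHP].
* R. Temam, *Navier–Stokes equations* (1977/79), Ch. III §3 (3.43)–(3.46) [Temam1979].
-/

noncomputable section

open MeasureTheory Set Function Filter Topology TopologicalSpace Metric
open scoped NNReal ENNReal InnerProductSpace RealInnerProductSpace

namespace Literature.Analysis.FluidPDE

namespace BradshawTsai2017

section GalerkinIdentity

variable {T : ℝ} {W : ℝ → EuclideanSpace ℝ (Fin 3) → EuclideanSpace ℝ (Fin 3)}
  {ρ : EuclideanSpace ℝ (Fin 3) → ℝ} {k : ℕ}
  {a : Fin k → EuclideanSpace ℝ (Fin 3) → EuclideanSpace ℝ (Fin 3)} {b : ℝ → EuclideanSpace ℝ (Fin k)}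

/-- The coefficient of `aᵢ` in `Σⱼ βⱼ aⱼ` is recovered by pairing with `aᵢ` (orthonormality).
[folklore] -/
theorem integral_inner_galerkinSum_basis
    (ha : ∀ i, FunctionSpaces.IsTestFunctionOn (⊤ : Opens (EuclideanSpace ℝ (Fin 3))) (a i))
    (hon : ∀ i j, ∫ y, ⟪a i y, a j y⟫ = if i = j then (1 : ℝ) else 0)
    (β : EuclideanSpace ℝ (Fin k)) (i : Fin k) :
    ∫ y, ⟪galerkinSum a β y, a i y⟫ = β i := by
  have hint : ∀ j, Integrable (fun y => ⟪a j y, a i y⟫) (volume : Measure (EuclideanSpace ℝ (Fin 3))) :=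
    fun j => ((ha j).contDiff.continuous.inner (ha i).contDiff.continuous).integrable_of_hasCompactSupport
      (HasCompactSupport.intro (ha i).hasCompactSupport fun y hy => by
        rw [image_eq_zero_of_notMem_tsupport hy, inner_zero_right])
  have e : (fun y => ⟪galerkinSum a β y, a i y⟫) = fun y => ∑ j, β j * ⟪a j y, a i y⟫ := by
    funext y
    rw [galerkinSum_apply, sum_inner]
    refine Finset.sum_congr rfl fun j _ => ?_
    rw [real_inner_smul_left]
  rw [e, integral_finsetSum _ fun j _ => (hint j).const_mul _]
  simp_rw [integral_const_mul, hon]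
  simp

/-- The derivative of a periodic function is periodic. [folklore] -/
theorem deriv_periodic_of_periodic {X : Type*} [NormedAddCommGroup X] [NormedSpace ℝ X]
    {f : ℝ → X} {c : ℝ} (hf : ∀ s, f (s + c) = f s) (s : ℝ) : deriv f (s + c) = deriv f s := by
  have e : f = fun x => f (x + c) := funext fun x => (hf x).symm
  conv_rhs => rw [e]
  rw [deriv_comp_add_const]

set_option maxHeartbeats 1600000 in
/-- **The Galerkin equations tested with time-dependent elements of the Galerkin space**
([BT1] Lemma 2.6 / proof of Thm 2.4; Temam Ch. III §3 (3.43)–(3.46)). See the module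
docstring. [cite: BradshawTsai2017AHP, Lemma 2.6 and proof of Thm 2.4; Temam1979, Ch. III §3 (3.43)–(3.46)] -/
theorem intervalIntegral_galerkin_identity (hT : 0 < T) (hW : ContDiff ℝ 1 (uncurry W))
    (hper : ∀ s y, W (s + T) y = W s y) (hρ : Continuous ρ) (hρc : HasCompactSupport ρ)
    (ha : ∀ i, FunctionSpaces.IsTestFunctionOn (⊤ : Opens (EuclideanSpace ℝ (Fin 3))) (a i))
    (hon : ∀ i j, ∫ y, ⟪a i y, a j y⟫ = if i = j then (1 : ℝ) else 0)
    (hb : ∀ s, HasDerivAt b (galerkinRHS W ρ a s (b s)) s) (hbT : ∀ s, b (s + T) = b s)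
    {g : ℝ → EuclideanSpace ℝ (Fin 3) → EuclideanSpace ℝ (Fin 3)}
    (hgs : ContDiff ℝ (⊤ : ℕ∞) (uncurry g)) (hgT : ∀ s y, g (s + T) y = g s y)
    {R : ℝ} (hgR : ∀ s y, R ≤ ‖y‖ → g s y = 0)
    (hgV : ∀ s, ∃ c : EuclideanSpace ℝ (Fin k), galerkinSum a c = g s) :
    ∫ s in (0 : ℝ)..T, ((∫ y, ⟪galerkinSum a (b s) y, timeDeriv g s y⟫) +
      galerkinForm W ρ s (galerkinSum a (b s)) (g s)) = 0 := by
  have hac : ∀ i, Continuous (a i) := fun i => (ha i).contDiff.continuous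
  have has : ∀ i, HasCompactSupport (a i) := fun i => (ha i).hasCompactSupport
  have hbc : Continuous b := continuous_iff_continuousAt.2 fun s => (hb s).continuousAt
  -- the solution stays in a ball
  obtain ⟨Rb, hRb⟩ : ∃ Rb : ℝ, ∀ s, b s ∈ closedBall (0 : EuclideanSpace ℝ (Fin k)) Rb := by
    obtain ⟨C, -, hC⟩ := exists_bound_of_continuous_periodic hbc.norm hT (fun s => by rw [hbT s])
    exact ⟨C, fun s => mem_closedBall_zero_iff.2 ((le_abs_self _).trans (hC s))⟩
  -- ## the coefficients `c(s)` of `g(s)` and their derivatives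
  choose cc hcc using hgV
  have hcci : ∀ s i, cc s i = ∫ y, ⟪g s y, a i y⟫ := fun s i => by
    rw [← hcc s, integral_inner_galerkinSum_basis ha hon]
  have hg1 : ContDiff ℝ 1 (uncurry g) := hgs.of_le (by exact_mod_cast le_top)
  -- the time derivative of `g`: jointly continuous, periodic, supported in the ball, bounded
  have hTc : Continuous fun z : ℝ × EuclideanSpace ℝ (Fin 3) => timeDeriv g z.1 z.2 :=
    (contDiff_uncurry_timeDeriv hgs).continuous
  have hTper : ∀ s y, timeDeriv g (s + T) y = timeDeriv g s y := fun s y =>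
    deriv_periodic_of_periodic (f := fun s => g s y) (fun s => hgT s y) s
  have hTR : ∀ z : ℝ × EuclideanSpace ℝ (Fin 3), z.2 ∉ ball (0 : EuclideanSpace ℝ (Fin 3)) R →
      timeDeriv g z.1 z.2 = 0 := fun z hz => by
    have hy : R ≤ ‖z.2‖ := by rwa [mem_ball_zero_iff, not_lt] at hz
    have e : (fun s => g s z.2) = fun _ => (0 : EuclideanSpace ℝ (Fin 3)) := funext fun s => hgR s z.2 hy
    show deriv (fun s => g s z.2) z.1 = 0
    rw [e, deriv_const]
  obtain ⟨B, -, hB⟩ := exists_global_bound_of_periodic hTc hT hTper hTR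
  have hgB : ∀ s y, ‖timeDeriv g s y‖ ≤ B := fun s y => hB (s, y)
  -- the derivative of the coefficients
  set cc' : ℝ → Fin k → ℝ := fun s i => ∫ y, ⟪timeDeriv g s y, a i y⟫ with hcc'
  have hccd : ∀ s i, HasDerivAt (fun σ => cc σ i) (cc' s i) s := fun s i => by
    have h := hasDerivAt_integral_inner_family_of_bound hg1 hgB (hac i) (has i) s
    have e : (fun σ => ∫ y, ⟪g σ y, a i y⟫) = fun σ => cc σ i := funext fun σ => (hcci σ i).symm
    rwa [e] at h
  have hcc'c : ∀ i, Continuous fun s => cc' s i := fun i => by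
    have hj : Continuous (uncurry fun s y => ⟪timeDeriv g s y, a i y⟫) :=
      hTc.inner ((hac i).comp continuous_snd)
    have h := continuous_parametric_integral_of_continuous
      (μ := (volume : Measure (EuclideanSpace ℝ (Fin 3)))) hj (has i).isCompact
    refine h.congr fun s => ?_
    refine setIntegral_eq_integral_of_forall_compl_eq_zero fun y hy => ?_
    rw [image_eq_zero_of_notMem_tsupport hy, inner_zero_right]
  have hccc : ∀ i, Continuous fun s => cc s i := fun i =>
    continuous_iff_continuousAt.2 fun s => (hccd s i).continuousAt
  have hccT : ∀ s i, cc (s + T) i = cc s i := fun s i => by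
    rw [hcci, hcci]; simp only [hgT s]
  -- `∂ₛg(s) = Σᵢ cᵢ'(s) aᵢ`
  have htd : ∀ s y, timeDeriv g s y = ∑ i, cc' s i • a i y := fun s y => by
    have e : (fun σ => g σ y) = fun σ => ∑ i, cc σ i • a i y := by
      funext σ; rw [← hcc σ, galerkinSum_apply]
    have hd : HasDerivAt (fun σ => ∑ i, cc σ i • a i y) (∑ i, cc' s i • a i y) s :=
      HasDerivAt.fun_sum fun i _ => (hccd s i).smul_const (a i y)
    show deriv (fun σ => g σ y) s = _
    rw [e, hd.deriv]
  -- ## the pairings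
  have hUai : ∀ s i, ∫ y, ⟪galerkinSum a (b s) y, a i y⟫ = b s i := fun s i =>
    integral_inner_galerkinSum_basis ha hon (b s) i
  have hUt : ∀ s, FunctionSpaces.IsTestFunctionOn (⊤ : Opens (EuclideanSpace ℝ (Fin 3)))
      (galerkinSum a (b s)) := fun s => isTestFunctionOn_galerkinSum ha (b s)
  have hpair : ∀ s, ∫ y, ⟪galerkinSum a (b s) y, timeDeriv g s y⟫ = ∑ i, cc' s i * b s i := by
    intro s
    have e : (fun y => ⟪galerkinSum a (b s) y, timeDeriv g s y⟫) =
        fun y => ∑ i, cc' s i * ⟪galerkinSum a (b s) y, a i y⟫ := by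
      funext y
      rw [htd s y, inner_sum]
      refine Finset.sum_congr rfl fun i _ => ?_
      rw [real_inner_smul_right]
    rw [e, integral_finsetSum _ fun i _ => ?_]
    · refine Finset.sum_congr rfl fun i _ => ?_
      rw [integral_const_mul, hUai]
    · refine (Integrable.const_mul ?_ _)
      exact ((hUt s).contDiff.continuous.inner (hac i)).integrable_of_hasCompactSupport
        (HasCompactSupport.intro (has i) fun y hy => by
          rw [image_eq_zero_of_notMem_tsupport hy, inner_zero_right])
  -- ## the derivative of `s ↦ ⟪b(s), c(s)⟫ = Σᵢ bᵢcᵢ`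
  have hSR : ∀ s, SliceRegular W s := fun s => SliceRegular.of_contDiff hW s
  have hbi : ∀ s i, HasDerivAt (fun σ => b σ i) (galerkinRHS W ρ a s (b s) i) s := fun s i => by
    have h := (EuclideanSpace.proj i).hasFDerivAt.comp_hasDerivAt s (hb s)
    simp only [Function.comp_def, EuclideanSpace.proj, PiLp.proj_apply] at h
    exact h
  have hF : ∀ s, HasDerivAt (fun σ => ∑ i, b σ i * cc σ i)
      (∑ i, (galerkinRHS W ρ a s (b s) i * cc s i + b s i * cc' s i)) s := fun s =>
    HasDerivAt.fun_sum fun i _ => (hbi s i).mul (hccd s i)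
  -- the derivative is the integrand
  have hF' : ∀ s, (∑ i, (galerkinRHS W ρ a s (b s) i * cc s i + b s i * cc' s i)) =
      (∫ y, ⟪galerkinSum a (b s) y, timeDeriv g s y⟫) +
        galerkinForm W ρ s (galerkinSum a (b s)) (g s) := by
    intro s
    rw [Finset.sum_add_distrib, hpair s, ← hcc s,
      ← inner_galerkinRHS_eq_galerkinForm_pair hρ hρc ha (hSR s) (b s) (cc s)]
    have e1 : ⟪galerkinRHS W ρ a s (b s), cc s⟫ = ∑ i, galerkinRHS W ρ a s (b s) i * cc s i := by
      simp [PiLp.inner_apply, mul_comm]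
    rw [e1, add_comm]
    refine congrArg₂ (· + ·) (Finset.sum_congr rfl fun i _ => by ring) rfl
  -- continuity of the integrand
  obtain ⟨K, hK⟩ := exists_lipschitzOnWith_galerkinRHS hT hW hper ha ρ Rb
  have hvb : Continuous fun s => galerkinRHS W ρ a s (b s) :=
    continuous_field_comp hbc hRb hK fun x => continuous_galerkinRHS hW ha x
  have hIc : Continuous fun s => ∑ i, (galerkinRHS W ρ a s (b s) i * cc s i + b s i * cc' s i) := by
    refine continuous_finsetSum _ fun i _ => ?_
    refine (((PiLp.continuous_apply 2 _ i).comp hvb).mul (hccc i)).add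
      (((PiLp.continuous_apply 2 _ i).comp hbc).mul (hcc'c i))
  -- ## integrate over a period
  have hFTC := intervalIntegral.integral_eq_sub_of_hasDerivAt (a := (0 : ℝ)) (b := T)
    (fun s _ => hF s) (hIc.intervalIntegrable _ _)
  have hperF : (∑ i, b T i * cc T i) = ∑ i, b 0 i * cc 0 i := by
    refine Finset.sum_congr rfl fun i _ => ?_
    have h1 := hbT 0
    have h2 := hccT 0 i
    rw [zero_add] at h1 h2
    rw [h1, h2]
  rw [hperF, sub_self] at hFTC
  refine Eq.trans (intervalIntegral.integral_congr fun s _ => ?_) hFTC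
  exact (hF' s).symm

end GalerkinIdentity

end BradshawTsai2017

end Literature.Analysis.FluidPDE

end
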